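import Mathlib
import Summits.Ventures.PercRepro2.SwAllMarkStepDefs
import Summits.Ventures.PercRepro2.SwAllFreeBits

/-!
# THE GENERAL MARK STEP, II: the theorem
(blind cell PercRepro2, night-4 g31, 2026-08-28; proofs/NIGHT4-G31.md)

**`swAll_of_gTyped_patterns`**: for ANY vertex `x ∉ {l, h}` (any degree, any neighbours, loops
included), row 2′SW-ALL with the mark at `x` follows from the general doubly typed row of night-4 g7
ON THE GRAPH WITH THE EDGES AT `x` DELETED (`isolate ends x`), taken at every colour PATTERN `d` of
the edges at `x` with the families `markU ends d x = {S ∣ S meets the red neighbours}`,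
`markD ends d x = {S ∣ S avoids the blue neighbours}`, `markD'' ends d x = {S ∣ S avoids the red
neighbours}`, `X = {x}`, `𝓤′ = univ`.  PROOF (counting form + Hall).  The side `Q_x` is partitioned
by the pattern `dpart D ζ` on the edges `D` at `x`; on the fibre of `d` it is the doubly typed class
of the isolated graph at the families of `d` (`mem_tgt_iff_gTypedQ`, `markU_eq_of_agree` …), and
that class is saturated on `D` while both edge sets of `h` of the isolated graph are blind to `D`
(`cluster_isolate_eq_of_agree`, `redEdges_isolate_eq_of_agree`), so its counting inequality
(`card_le_of_gTypedSwAll`) restricts to the fibre by FREE BITS (`card_filter_le_of_free_bits`); on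
`Q_x` the red edge set of `h` is that of the isolated graph (`redEdges_eq_isolate_of_mem_tgt`) and
the blue one contains it (`blueEdges_isolate_subset`).  Summing over the patterns
(`Finset.card_eq_sum_card_fiberwise`) gives `card_le_markStep`, and Hall
(`exists_swAll_injection_of_card_le`) the injection.  COROLLARIES: the step is unconditional on the
classes where g30 has the doubly typed row — `swAll_markStep_of_outEdges` (g10's class of the
isolated graph: every vertex other than `l, h, x` joined to `l` or hanging on `x` only), and on
g28's never-core / bridge classes and g11's one-junction class through the conditional theorem
(next file).  It contains g27's leaf-mark step and g30's H-, L- and LH-mark steps (the pattern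
families at those marks are instances) and gives the series-mark step with two arbitrary
neighbours.
-/

namespace Summit.Ventures.PercRepro2

namespace LocRows

open Hull

variable {V : Type*} {E : Type*} [Fintype E] [DecidableEq E]

open scoped Classical

section Counting

variable {ends : E → Sym2 V} {l h : V}

/-- **The general doubly typed row gives the rigid counting inequality** on its class, for every
up-set of edge sets. -/
lemma card_le_of_gTypedSwAll {𝓤 𝓓 𝓓'' : Set (Set V)} {X : Set V} {𝓤' : Set (Set V)}
    (hs : GTypedSwAll ends l h 𝓤 𝓓 𝓓'' X 𝓤') (𝓔 : Set (Set E)) (h𝓔 : IsUpperSet 𝓔) :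
    ((gTypedQ ends l h 𝓤 𝓓 𝓓'' X 𝓤').filter fun ζ => redEdges ends ζ h ∈ 𝓔).card ≤
      ((gTypedQ ends l h 𝓤 𝓓 𝓓'' X 𝓤').filter fun ζ => blueEdges ends ζ h ∈ 𝓔).card := by
  obtain ⟨f, hf, hmem⟩ := hs
  refine Finset.card_le_card_of_injOn (fun ζ => if hζ : ζ ∈ gTypedQ ends l h 𝓤 𝓓 𝓓'' X 𝓤'
    then f ⟨ζ, hζ⟩ else ζ) ?_ ?_
  · intro ζ hζ
    rw [Finset.mem_coe, Finset.mem_filter] at hζ ⊢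
    obtain ⟨hQ, hR⟩ := hζ
    simp only [hQ, dite_true]
    refine ⟨(hmem ⟨ζ, hQ⟩).1, h𝓔 ?_ hR⟩
    intro e' he'
    obtain ⟨hred, hin⟩ := he'
    have hsub := cluster_subset_of_red_flipped ends (hmem ⟨ζ, hQ⟩).2
    refine ⟨blue_eq_true_iff.2 ((hmem ⟨ζ, hQ⟩).2 e' hin hred), ?_⟩
    obtain ⟨a, ha, b, hb, hab⟩ := hin
    exact ⟨a, hsub ha, b, hsub hb, hab⟩
  · intro ζ hζ ζ' hζ' heq
    rw [Finset.mem_coe, Finset.mem_filter] at hζ hζ'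
    simp only [hζ.1, hζ'.1, dite_true] at heq
    exact congrArg Subtype.val (hf heq)

end Counting

section Theorem

variable {ends : E → Sym2 V} {x l h : V} (hxl : x ≠ l) (hxh : x ≠ h)
include hxl hxh

/-- **The rigid counting inequality on the side of an arbitrary mark `x`** from the general doubly
typed row of the isolated graph on every colour pattern of the edges at `x`. -/
theorem card_le_markStep
    (hg : ∀ d ∈ pats {e | x ∈ ends e}, GTypedSwAll (isolate ends x) l h (markU ends d x)
      (markD ends d x) (markD'' ends d x) {x} Set.univ)
    (𝓔 : Set (Set E)) (h𝓔 : IsUpperSet 𝓔) :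
    ((tgtU ends l h {S : Set V | x ∈ S}).filter fun ζ => redEdges ends ζ h ∈ 𝓔).card ≤
      ((tgtU ends l h {S : Set V | x ∈ S}).filter fun ζ => blueEdges ends ζ h ∈ 𝓔).card := by
  have hhx : h ≠ x := hxh.symm
  set D : Set E := {e | x ∈ ends e} with hD
  set Qx := tgtU ends l h {S : Set V | x ∈ S} with hQx
  set SR := Qx.filter fun ζ => redEdges ends ζ h ∈ 𝓔 with hSR
  set SB := Qx.filter fun ζ => blueEdges ends ζ h ∈ 𝓔 with hSB
  have hmapR : ∀ ζ ∈ SR, dpart D ζ ∈ pats D := fun ζ _ => dpart_mem_pats ζ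
  have hmapB : ∀ ζ ∈ SB, dpart D ζ ∈ pats D := fun ζ _ => dpart_mem_pats ζ
  rw [Finset.card_eq_sum_card_fiberwise hmapR, Finset.card_eq_sum_card_fiberwise hmapB]
  refine Finset.sum_le_sum fun d hd => ?_
  -- the fibre of the pattern `d`
  set T := gTypedQ (isolate ends x) l h (markU ends d x) (markD ends d x) (markD'' ends d x)
    {x} Set.univ with hT
  -- the pattern, kept opaque so that every `filter Pat` carries the same (classical) instance
  obtain ⟨Pat, hPat_def⟩ : ∃ Pat : Config E → Prop, ∀ ζ, Pat ζ ↔ dpart D ζ = d :=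
    ⟨_, fun _ => Iff.rfl⟩
  have hagD : ∀ ζ, Pat ζ → ∀ e, x ∈ ends e → ζ e = d e := by
    intro ζ hζ e he
    rw [hPat_def] at hζ
    rw [← hζ, dpart_apply_of_mem (show e ∈ D from he)]
  -- on the fibre, the side of `x` is the class `T`
  have hfib : ∀ ζ, Pat ζ → (ζ ∈ Qx ↔ ζ ∈ T) := by
    intro ζ hζ
    rw [hQx, mem_tgt_iff_gTypedQ hxl hxh, hT, markU_eq_of_agree (hagD ζ hζ),
      markD_eq_of_agree (hagD ζ hζ), markD''_eq_of_agree (hagD ζ hζ)]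
  have hS : ∀ ζ ∈ T, ∀ ζ', (∀ e, e ∉ D → ζ' e = ζ e) → ζ' ∈ T := by
    intro ζ hζ ζ' hag
    have hag' : ∀ e, x ∉ ends e → ζ' e = ζ e := hag
    have hagb : ∀ e, x ∉ ends e → blue ζ' e = blue ζ e := fun e he => by
      rw [blue_apply, blue_apply, hag' e he]
    rw [hT, mem_gTypedQ] at hζ ⊢
    simp only [hull] at hζ ⊢
    rw [cluster_isolate_eq_of_agree hag' l, cluster_isolate_eq_of_agree hagb l,
      cluster_isolate_eq_of_agree hag' h, cluster_isolate_eq_of_agree hagb h]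
    exact hζ
  have hPR : ∀ ζ ζ', (∀ e, e ∉ D → ζ' e = ζ e) →
      redEdges (isolate ends x) ζ h ∈ 𝓔 → redEdges (isolate ends x) ζ' h ∈ 𝓔 := by
    intro ζ ζ' hag hR
    rw [redEdges_isolate_eq_of_agree hhx hag]
    exact hR
  have hPB : ∀ ζ ζ', (∀ e, e ∉ D → ζ' e = ζ e) →
      blueEdges (isolate ends x) ζ h ∈ 𝓔 → blueEdges (isolate ends x) ζ' h ∈ 𝓔 := by
    intro ζ ζ' hag hBl
    rw [blueEdges_isolate_eq_of_agree hhx hag]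
    exact hBl
  have hPat : ∀ ζ ζ', (∀ e, e ∈ D → ζ' e = ζ e) → Pat ζ → Pat ζ' := by
    intro ζ ζ' hag hζ
    rw [hPat_def] at hζ ⊢
    rw [← hζ]
    funext e
    by_cases he : e ∈ D
    · rw [dpart_apply_of_mem he, dpart_apply_of_mem he, hag e he]
    · rw [dpart_apply_of_notMem he, dpart_apply_of_notMem he]
  have hle : (T.filter fun ζ => redEdges (isolate ends x) ζ h ∈ 𝓔).card ≤
      (T.filter fun ζ => blueEdges (isolate ends x) ζ h ∈ 𝓔).card :=
    card_le_of_gTypedSwAll (hg d hd) 𝓔 h𝓔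
  have key := card_filter_le_of_free_bits (D := D) T hS _ _ hPR hPB Pat hPat hle
  -- the red fibre is the red side of `T` on the pattern
  have eR : (SR.filter fun ζ => dpart D ζ = d) =
      (T.filter fun ζ => redEdges (isolate ends x) ζ h ∈ 𝓔).filter Pat := by
    ext ζ
    simp only [hSR, Finset.mem_filter, hPat_def]
    constructor
    · rintro ⟨⟨hQ, hR⟩, hp⟩
      refine ⟨⟨(hfib ζ ((hPat_def ζ).2 hp)).1 hQ, ?_⟩, hp⟩
      rw [← redEdges_eq_isolate_of_mem_tgt hxh hQ]
      exact hR
    · rintro ⟨⟨hQ, hR⟩, hp⟩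
      have hQx' : ζ ∈ Qx := (hfib ζ ((hPat_def ζ).2 hp)).2 hQ
      exact ⟨⟨hQx', by rw [redEdges_eq_isolate_of_mem_tgt hxh hQx']; exact hR⟩, hp⟩
  -- the blue side of `T` on the pattern lies in the blue fibre
  have eB : ((T.filter fun ζ => blueEdges (isolate ends x) ζ h ∈ 𝓔).filter Pat) ⊆
      SB.filter fun ζ => dpart D ζ = d := by
    intro ζ hζ
    simp only [hSB, Finset.mem_filter, hPat_def] at hζ ⊢
    obtain ⟨⟨hQ, hBl⟩, hp⟩ := hζ
    have hQx' : ζ ∈ Qx := (hfib ζ ((hPat_def ζ).2 hp)).2 hQ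
    exact ⟨⟨hQx', h𝓔 (blueEdges_isolate_subset hhx) hBl⟩, hp⟩
  rw [eR]
  exact key.trans (Finset.card_le_card eB)

/-- **THE GENERAL MARK STEP**: row 2′SW-ALL with the mark at ANY vertex `x ∉ {l, h}` follows from
the general doubly typed row of the graph with the edges at `x` deleted, on every colour pattern
`d` of the edges at `x`, at the families `{S ∣ S meets the red neighbours of x}`,
`{S ∣ S avoids the blue neighbours}`, `{S ∣ S avoids the red neighbours}`, `X = {x}`. -/
theorem swAll_of_gTyped_patterns
    (hg : ∀ d ∈ pats {e | x ∈ ends e}, GTypedSwAll (isolate ends x) l h (markU ends d x)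
      (markD ends d x) (markD'' ends d x) {x} Set.univ) : SwAll ends l h x :=
  exists_swAll_injection_of_card_le h _ (card_le_markStep hxl hxh hg)

/-- **Row (SW) with the mark at any vertex** from the doubly typed row of the isolated graph. -/
theorem sw_of_gTyped_patterns
    (hg : ∀ d ∈ pats {e | x ∈ ends e}, GTypedSwAll (isolate ends x) l h (markU ends d x)
      (markD ends d x) (markD'' ends d x) {x} Set.univ) : Sw ends l h x :=
  sw_of_swAll ends (swAll_of_gTyped_patterns hxl hxh hg)

end Theorem

section Corollaries

variable {ends : E → Sym2 V} {x l h : V}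

omit [Fintype E] [DecidableEq E] in
/-- In the isolated graph `x` is exempt from the outside-edge hypothesis (`x ∈ X`), a vertex
joined to `l` in the graph is joined to `l` in the isolated graph, and a vertex whose every edge
goes to `x` is isolated. -/
lemma isolate_hout (hxl : x ≠ l)
    (hout : ∀ y, y ≠ l → y ≠ h → y ≠ x →
      (∃ e, ends e = s(y, l)) ∨ (∀ e, y ∈ ends e → x ∈ ends e)) (d : Config E) :
    ∀ y, y ≠ l → y ≠ h → (∀ S ∈ markU ends d x, y ∈ S) ∨ (∀ S ∈ markD'' ends d x, y ∉ S) ∨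
      y ∈ ({x} : Set V) ∨ (∃ e, isolate ends x e = s(y, l)) ∨ (∀ e, y ∉ isolate ends x e) := by
  intro y hyl hyh
  by_cases hyx : y = x
  · exact Or.inr (Or.inr (Or.inl (by simp [hyx])))
  rcases hout y hyl hyh hyx with ⟨e, he⟩ | hiso
  · exact Or.inr (Or.inr (Or.inr (Or.inl ⟨e, isolate_eq_of_ends_eq hyx hxl.symm he⟩)))
  · refine Or.inr (Or.inr (Or.inr (Or.inr fun e hye => ?_)))
    by_cases hxe : x ∈ ends e
    · rw [isolate_apply_of_mem hxe, Sym2.mem_iff] at hye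
      rcases hye with h' | h' <;> exact hyx h'
    · rw [isolate_apply_of_notMem hxe] at hye
      exact hxe (hiso e hye)

omit [Fintype E] [DecidableEq E] in
/-- No loop at `h` in the isolated graph when there is none in the graph. -/
lemma isolate_hloop (hxh : x ≠ h) (hloop : ∀ e, ends e ≠ s(h, h)) :
    ∀ e, isolate ends x e ≠ s(h, h) := by
  intro e he
  by_cases hxe : x ∈ ends e
  · rw [isolate_apply_of_mem hxe, Sym2.eq_iff] at he
    rcases he with ⟨h', -⟩ | ⟨h', -⟩ <;> exact hxh h'
  · rw [isolate_apply_of_notMem hxe] at he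
    exact hloop e he

/-- **THE GENERAL MARK STEP ON g10's CLASS OF THE ISOLATED GRAPH** (unconditional): row 2′SW-ALL
with the mark at `x ∉ {l, h}` on every graph without loop at `h` in which every vertex other than
`l, h, x` is joined to `l` or has all its edges at `x` — the mark itself arbitrary. -/
theorem swAll_markStep_of_outEdges (hlh : l ≠ h) (hloop : ∀ e, ends e ≠ s(h, h)) (hxl : x ≠ l)
    (hxh : x ≠ h)
    (hout : ∀ y, y ≠ l → y ≠ h → y ≠ x →
      (∃ e, ends e = s(y, l)) ∨ (∀ e, y ∈ ends e → x ∈ ends e)) : SwAll ends l h x := by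
  refine swAll_of_gTyped_patterns hxl hxh fun d _ => ?_
  exact gTypedSwAll_of_outEdges hlh (isolate_hloop hxh hloop) (isUpperSet_markU d x)
    (isLowerSet_markD d x) (isLowerSet_markD'' d x) isUpperSet_univ (isolate_hout hxl hout d)

/-- **Row (SW) on the same class.** -/
theorem sw_markStep_of_outEdges (hlh : l ≠ h) (hloop : ∀ e, ends e ≠ s(h, h)) (hxl : x ≠ l)
    (hxh : x ≠ h)
    (hout : ∀ y, y ≠ l → y ≠ h → y ≠ x →
      (∃ e, ends e = s(y, l)) ∨ (∀ e, y ∈ ends e → x ∈ ends e)) : Sw ends l h x :=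
  sw_of_swAll ends (swAll_markStep_of_outEdges hlh hloop hxl hxh hout)

end Corollaries

end LocRows

end Summit.Ventures.PercRepro2
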